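import Summits.ResolutionOfSingularities.ResolutionOfSingularities.Theorems.EquisingularLiftEquisingularLiftNatClusterPointChartChange
import Summits.ResolutionOfSingularities.ResolutionOfSingularities.Theorems.EquisingularLiftEquisingularLiftNatExceptionalTracePrimes
import Summits.ResolutionOfSingularities.ResolutionOfSingularities.Theorems.EquisingularLiftEquisingularLiftNatTCPlusPlusInvDefs
import HarnessLib

/-!
# [OURS · L1 W4.5(b) · EL♮(3)] (δ) D3 POINT-DICT, part 2b (D3c COVER): every closed NON-REGULAR point of the reduced carrier curve
# `Z₂ = υ⁻¹{x} ∩ St W ⊂ υ⁻¹{x} ≅ ℙ²` IS one of the cluster points `y′_t` — `TCPlusPlus.Cand F₂ Z₂ ∅ ⊆ Set.range y′`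

Crux chain w45b (cell `res-hironaka`, slot W4.5(b)), working crux **EL♮** = stmt-ResolutionOfSingularities-20038, child **EL♮(3)** =
stmt-ResolutionOfSingularities-20148, route EquisingularLift, line `sections`, registered stub `stub_elnat_tcPlusPlusPointResolution`
(v2); brick **(δ) D3 POINT-DICT** (res-L1-w45b-stub-3 `DELTA-PLAN.md`; res-L1-w45b-plan-1 DE-COLLISION 2026-08-27T17:03:18Z: D3 whole
:= res-type-100). HONEST FRAMING: OURS; NOT a statement of any manuscript; AI-written, weaker than expert review. No `sorry`; standard
axioms. DEF-FREE. `--supports stmt-ResolutionOfSingularities-20148 --as helper`.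

WHY. The TC⁺⁺ invariant `TCPlusPlus.Inv` (p547095) asks one `TCPlus.Member` per subset `S ⊆ Cand F₂ Z₂ ∅` of the untracked candidate
centres (closed non-regular points of `V(Z₂)_red`); the ring-side cone of res-L1-w45b-stub-3's D1 (p548257) is centred at a subset of the
FAT CLUSTER of `CarrierCluster₂`, whose COVER clause lists — chart by chart, as maximal ideals of `k'[T_l : l ≠ j]` — every prime at
which the reduced tangent form is not regular. This file closes the loop: a candidate centre IS a cluster point `y′_t` (part 1 / res-D-pv-051's
…NatClusterPointDictA: the point with chart-`i t` coordinates `a t`).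

WHAT (namespace `…Cruxes.EquisingularLiftNat.Sections`).
* (part 2a …NatClusterPointChartChange: the CHART CHANGE of a coordinate point — visible on the chart `m` when `b_m` is a unit, with
  coordinates `b_l/b_m` there.)
* **`eq_clusterPoint_of_forall_frac_sub_mem`** — a point over `x` whose chart-`jj` coordinates lift `â_t/â_t jj` (member `t` visible on
  `jj`) IS `y′ t` (same chart: part 1's uniqueness D3a′; else chart change `jj → i t` of part 2a, then D3a′). Pure point dictionary (no cone).
* **`exists_eq_clusterPoint_of_not_isRegularLocalRing`** — in res-L1-w45b-stub-2's `finite_badPrimes_of_finite_nonregular_carrierTrace`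
  currency (p526020: frame `c̄` of `𝔪_x` quasi-regular, residue model `πk : 𝒪_{F₁,x} ↠ k'` of kernel `(c̄)`, `𝓘(W̄)_x = (Φ(c̄))`, `G` with
  (R1)/(R2) so that `Z₂ = V₊(ḡ)` reduced, `ḡ = πk_* G`), PLUS the COVER clause of `FatCluster ḡ s i a m` and the cluster points
  `y′ : Fin s → F₂` with their chart-`i t` presentations and coordinate clauses (part 1 `exists_clusterPoint`): every point `w ∈ Z₂` at
  which `𝒪_{F₂,w} ⧸ 𝓘(Z₂)_w` is NOT regular is some `y′ t`. ROUTE: present `w` on a chart `jj` (tree); `𝔔 = Θ⁻¹𝔮` for the chart map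
  `Θ : 𝒪_{F₁,x}[𝔪/c̄_jj] ↠ k'[T_l : l ≠ jj]` (Stacks 0BIQ); `w ∈ Z₂ ⇒ ḡ_jj ∈ 𝔮`; the trace local ring is `(k'[T]/(ḡ_jj))_𝔮`
  (`exists_surjective_ker_eq_of_isLocalization_comap`), so non-regular ⇒ `ḡ_jj ∈ 𝔪_𝔮²` ((Δ1) iff of res-type-032); COVER ⇒ `𝔮` = the
  point ideal of `â_t/â_t jj`; lift ⇒ `w` has chart-`jj` coordinates `â_t/â_t jj`; if `jj = i t` part 1's uniqueness (D3a′) gives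
  `w = y′ t`, else the coordinate `â_t (i t)/â_t jj = 1/â_t jj` is a unit, CHART CHANGE to `i t` gives coordinates `a t`, then D3a′.
* **`cand_subset_range_clusterPoint`** (D3c as booked) — `TCPlusPlus.Cand F₂ (υ⁻¹{x} ∩ closure υ⁻¹(W ∖ {x})) ∅ ⊆ Set.range y′`.

References: res-L1-w45b-stub-2 T-PTPRIME-DICT (p526020, p540294); res-type-032 …NatDeltaCriterion; res-D-pv-051 …NatClusterPointDictA
(p550366); The Stacks Project, Tags 0804, 052P, 0BIQ [cite: StacksProject, Tag 0804; StacksProject, Tag 0BIQ].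
-/

set_option linter.dupNamespace false -- mandated namespace `Summit.<Summit>.<Problem>` of this single-conjunct summit

noncomputable section

open CategoryTheory CategoryTheory.Limits AlgebraicGeometry TopologicalSpace IsLocalRing
open Literature.AlgebraicGeometry.Resolution
open AlgebraicGeometry.Scheme.IdealSheafData

namespace Summit.ResolutionOfSingularities.ResolutionOfSingularities.Cruxes.EquisingularLiftNat.Sections

universe u

/-! ## 2. (D3c) A non-regular point of the reduced carrier curve is a cluster point -/

section Cover

variable {F₁ F₂ : Scheme.{0}} {υ : F₂ ⟶ F₁} {x : F₁}

set_option maxHeartbeats 800000 in -- subalgebra-of-localisation instances are slow (cf. p526020)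
/-- **A point with the coordinates of a cluster member IS that cluster point.** Cluster points `y′ t` over `x` presented on their charts
`c̄_{i t}` with coordinates `wp t` lifting `a t` (part 1 / res-D-pv-051's `exists_clusterPoint_presentation`), residue model `πk` of kernel
`(c̄) = 𝔪_x`. If a point `w` over `x`, presented on a chart `jj` on which the member `t` is visible (`â_t jj ≠ 0`, `â_t` the homogeneous
coordinate vector of `t`), has chart-`jj` coordinates lifting `â_t/â_t jj`, then `w = y′ t`: on the same chart by part 1's uniqueness
(D3a′), otherwise after the CHART CHANGE `jj → i t` of part 2a (the coordinate `â_t (i t)/â_t jj = 1/â_t jj` is a unit).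
[cite: StacksProject, Tag 0804] [OURS · L1 W4.5b] (δ) D3 POINT-DICT; NOT a statement of the manuscript. -/
theorem eq_clusterPoint_of_forall_frac_sub_mem (hx : IsClosed ({x} : Set F₁)) (hυ : IsBlowup υ (vanishingIdeal ⟨{x}, hx⟩))
    (c : Fin 3 → F₁.presheaf.stalk x) (hc𝔪 : Ideal.span (Set.range c) = maximalIdeal (F₁.presheaf.stalk x))
    {k' : Type} [Field k'] (πk : F₁.presheaf.stalk x →+* k') (hkerπ : RingHom.ker πk = Ideal.span (Set.range c))
    {s : ℕ} (i : Fin s → Fin 3) (a : (t : Fin s) → {j : Fin 3 // j ≠ i t} → k')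
    (y' : Fin s → F₂) (hy' : ∀ t, υ (y' t) = x)
    (𝔮p : ∀ t, PrimeSpectrum (blowupAlgebra (Ideal.span (Set.range c)) (c (i t))))
    (χp : ∀ t, blowupAlgebra (Ideal.span (Set.range c)) (c (i t)) →+* F₂.presheaf.stalk (y' t))
    (hχp : ∀ t r, χp t (algebraMap _ _ r) = ((F₁.presheaf.stalkCongr (.of_eq (hy' t))).inv ≫ υ.stalkMap (y' t)).hom r)
    (hlocp : ∀ t, @IsLocalization.AtPrime _ _ (F₂.presheaf.stalk (y' t)) _ (χp t).toAlgebra (𝔮p t).asIdeal _)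
    (h𝔮p : ∀ t, (𝔮p t).asIdeal.comap (algebraMap _ (blowupAlgebra (Ideal.span (Set.range c)) (c (i t)))) =
      maximalIdeal (F₁.presheaf.stalk x))
    (wp : ∀ t, {l : Fin 3 // l ≠ i t} → F₁.presheaf.stalk x) (hwp : ∀ t l, πk (wp t l) = a t l)
    (hfrp : ∀ t (l : {l : Fin 3 // l ≠ i t}), blowupAlgebra.frac c (i t) l.1 - algebraMap _ _ (wp t l) ∈ (𝔮p t).asIdeal)
    (t : Fin s) (jj : Fin 3) (hât : (if h : jj = i t then (1 : k') else a t ⟨jj, h⟩) ≠ 0)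
    (w : F₂) (hwx : υ w = x) (𝔔 : PrimeSpectrum (blowupAlgebra (Ideal.span (Set.range c)) (c jj)))
    (χ : blowupAlgebra (Ideal.span (Set.range c)) (c jj) →+* F₂.presheaf.stalk w)
    (hχ : ∀ r, χ (algebraMap _ _ r) = ((F₁.presheaf.stalkCongr (.of_eq hwx)).inv ≫ υ.stalkMap w).hom r)
    (hloc : @IsLocalization.AtPrime _ _ (F₂.presheaf.stalk w) _ χ.toAlgebra 𝔔.asIdeal _)
    (h𝔔 : 𝔔.asIdeal.comap (algebraMap _ (blowupAlgebra (Ideal.span (Set.range c)) (c jj))) =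
      maximalIdeal (F₁.presheaf.stalk x))
    (bR : {l : Fin 3 // l ≠ jj} → F₁.presheaf.stalk x)
    (hbR : ∀ l, πk (bR l) =
      (if h : (l : Fin 3) = i t then (1 : k') else a t ⟨l, h⟩) / (if h : jj = i t then (1 : k') else a t ⟨jj, h⟩))
    (hfrw : ∀ l : {l : Fin 3 // l ≠ jj}, blowupAlgebra.frac c jj l.1 - algebraMap _ _ (bR l) ∈ 𝔔.asIdeal) :
    w = y' t := by
  classical
  have hcJ : Ideal.span (Set.range c) = stalkIdeal (vanishingIdeal ⟨{x}, hx⟩) x := by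
    rw [hc𝔪, stalkIdeal_vanishingIdeal_singleton hx]
  -- constants differing by an element of `ker πk = 𝔪_x` may be exchanged in a coordinate clause
  have hexch : ∀ (j' : Fin 3) (𝔓 : Ideal (blowupAlgebra (Ideal.span (Set.range c)) (c j')))
      (h𝔓 : 𝔓.comap (algebraMap _ (blowupAlgebra (Ideal.span (Set.range c)) (c j'))) = maximalIdeal (F₁.presheaf.stalk x))
      (z : blowupAlgebra (Ideal.span (Set.range c)) (c j')) (r r' : F₁.presheaf.stalk x),
      z - algebraMap _ _ r ∈ 𝔓 → πk r = πk r' → z - algebraMap _ _ r' ∈ 𝔓 := by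
    intro j' 𝔓 h𝔓 z r r' hz hrr
    have hdiff : r - r' ∈ maximalIdeal (F₁.presheaf.stalk x) := by
      rw [← hc𝔪, ← hkerπ, RingHom.mem_ker, map_sub, hrr, sub_self]
    have hmem : algebraMap _ (blowupAlgebra (Ideal.span (Set.range c)) (c j')) (r - r') ∈ 𝔓 := by
      rw [← Ideal.mem_comap, h𝔓]; exact hdiff
    have := 𝔓.add_mem hz hmem
    rwa [map_sub, sub_add_sub_cancel] at this
  -- same chart: (D3a′); other chart: change charts first
  by_cases hjt : jj = i t
  · subst hjt
    refine eq_of_chartPresentation_of_forall_frac_sub_mem hυ hwx (hy' t) c (i t) 𝔔 (𝔮p t) χ (χp t) hχ (hχp t)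
      hloc (hlocp t) h𝔔 (h𝔮p t) (wp t) (fun l => ?_) (hfrp t)
    refine hexch (i t) 𝔔.asIdeal h𝔔 _ (bR l) (wp t l) (hfrw l) ?_
    rw [hbR, hwp, dif_pos rfl, div_one, dif_neg l.2]
  · have hm : i t ≠ jj := fun h => hjt h.symm
    have hajj : (if h : jj = i t then (1 : k') else a t ⟨jj, h⟩) ≠ 0 := hât
    have hunit : IsUnit (bR ⟨i t, hm⟩) := by
      by_contra hnu
      have hmem : bR ⟨i t, hm⟩ ∈ RingHom.ker πk := by
        rw [hkerπ, hc𝔪]; exact (mem_maximalIdeal _).mpr hnu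
      rw [RingHom.mem_ker, hbR, dif_pos rfl] at hmem
      exact one_ne_zero ((div_eq_zero_iff.mp hmem).resolve_right hajj)
    obtain ⟨𝔔', χ', hχ', hloc', h𝔔'⟩ :=
      exists_chartPresentation_of_isUnit_coord hυ hwx c hcJ jj (i t) hm 𝔔 χ hχ hloc bR hfrw hunit
    have hco := forall_frac_sub_mem_of_chartChange hυ hwx c hcJ jj (i t) hm 𝔔 χ hχ hloc bR hfrw hunit 𝔔' χ' hχ' hloc'
    refine eq_of_chartPresentation_of_forall_frac_sub_mem hυ hwx (hy' t) c (i t) 𝔔' (𝔮p t) χ' (χp t) hχ' (hχp t)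
      hloc' (hlocp t) h𝔔' (h𝔮p t) (wp t) (fun l => ?_) (hfrp t)
    refine hexch (i t) 𝔔'.asIdeal h𝔔' _ _ (wp t l) (hco l) ?_
    -- `πk (B l · bR_{i t}⁻¹) = a t l`
    have hu1 : πk (↑hunit.unit⁻¹ : F₁.presheaf.stalk x) * πk (bR ⟨i t, hm⟩) = 1 := by
      rw [← map_mul, IsUnit.val_inv_mul, map_one]
    have hπu : πk (bR ⟨i t, hm⟩) = 1 / (if h : jj = i t then (1 : k') else a t ⟨jj, h⟩) := by
      rw [hbR, dif_pos rfl]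
    have hinv : πk (↑hunit.unit⁻¹ : F₁.presheaf.stalk x) = (if h : jj = i t then (1 : k') else a t ⟨jj, h⟩) := by
      have := hu1
      rw [hπu, one_div, mul_inv_eq_one₀ hajj] at this
      rw [this]
    rw [map_mul, hinv, hwp]
    by_cases hl : (l : Fin 3) = jj
    · rw [dif_pos hl, map_one, one_mul, dif_neg hjt]
      congr 1
      exact Subtype.ext hl.symm
    · rw [dif_neg hl, hbR, dif_neg l.2, div_mul_cancel₀ _ hajj]


set_option maxHeartbeats 1600000 in -- long assembly; subalgebra-of-localisation instances are slow (cf. p526020, p509910)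
/-- **(D3c, pointwise) A NON-REGULAR POINT OF THE REDUCED CARRIER CURVE IS A CLUSTER POINT.** Setting of res-L1-w45b-stub-2's
`finite_badPrimes_of_finite_nonregular_carrierTrace` (`υ` the blowing up of the closed point `x`, `c̄` a quasi-regular frame of `𝔪_x`,
`πk : 𝒪_{F₁,x} ↠ k'` with kernel `(c̄)`, `𝓘(W̄)_x = (Φ(c̄))`, `G` with (R1)/(R2), `ḡ = πk_* G` a non-zero form), the COVER clause of a
`FatCluster ḡ s i a m`, and cluster points `y′ t ∈ F₂` over `x` presented on the chart `c̄_{i t}` with coordinates `w♯ t` lifting `a t`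
(part 1 / res-D-pv-051's `exists_clusterPoint_presentation`). Then every point `w` of `Z₂ = υ⁻¹{x} ∩ closure υ⁻¹(W ∖ {x})` at which
`𝒪_{F₂,w} ⧸ 𝓘(Z₂)_w` is not a regular local ring equals some `y′ t`. [cite: StacksProject, Tag 0804; StacksProject, Tag 0BIQ] -/
theorem exists_eq_clusterPoint_of_not_isRegularLocalRing [IsLocallyNoetherian F₂] (hx : IsClosed ({x} : Set F₁))
    (hυ : IsBlowup υ (vanishingIdeal ⟨{x}, hx⟩))
    (c : Fin 3 → F₁.presheaf.stalk x) (hc𝔪 : Ideal.span (Set.range c) = maximalIdeal (F₁.presheaf.stalk x))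
    (hc : IsQuasiRegular c) {k' : Type} [Field k'] (πk : F₁.presheaf.stalk x →+* k') (hπk : Function.Surjective πk)
    (hkerπ : RingHom.ker πk = Ideal.span (Set.range c)) (W : Closeds F₁) {d : ℕ}
    (Φ G : MvPolynomial (Fin 3) (F₁.presheaf.stalk x))
    (hΦd : Φ.IsHomogeneous d) (hΦ : MvPolynomial.map (Ideal.Quotient.mk (Ideal.span (Set.range c))) Φ ≠ 0)
    (hW : stalkIdeal (vanishingIdeal W) x = Ideal.span {MvPolynomial.eval c Φ})
    (hΦG : MvPolynomial.map (Ideal.Quotient.mk (Ideal.span (Set.range c))) Φ ∈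
      (Ideal.span {MvPolynomial.map (Ideal.Quotient.mk (Ideal.span (Set.range c))) G}).radical)
    (hGΦ : MvPolynomial.map (Ideal.Quotient.mk (Ideal.span (Set.range c))) G ∈
      (Ideal.span {MvPolynomial.map (Ideal.Quotient.mk (Ideal.span (Set.range c))) Φ}).radical)
    (hGrad : ∀ j, (Ideal.span {MvPolynomial.map (Ideal.Quotient.mk (Ideal.span (Set.range c)))
      (dehomogenize j G)}).IsRadical)
    {dg : ℕ} (hgdg : (MvPolynomial.map πk G).IsHomogeneous dg) (hg0 : MvPolynomial.map πk G ≠ 0)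
    (hZ : IsClosed (υ ⁻¹' {x} ∩ closure (υ ⁻¹' ((W : Set F₁) \ {x}))))
    {s : ℕ} (i : Fin s → Fin 3) (a : (t : Fin s) → {j : Fin 3 // j ≠ i t} → k') (m : Fin s → ℕ)
    (hF : FatCluster (MvPolynomial.map πk G) s i a m)
    (y' : Fin s → F₂) (hy' : ∀ t, υ (y' t) = x)
    (𝔮p : ∀ t, PrimeSpectrum (blowupAlgebra (Ideal.span (Set.range c)) (c (i t))))
    (χp : ∀ t, blowupAlgebra (Ideal.span (Set.range c)) (c (i t)) →+* F₂.presheaf.stalk (y' t))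
    (hχp : ∀ t r, χp t (algebraMap _ _ r) = ((F₁.presheaf.stalkCongr (.of_eq (hy' t))).inv ≫ υ.stalkMap (y' t)).hom r)
    (hlocp : ∀ t, @IsLocalization.AtPrime _ _ (F₂.presheaf.stalk (y' t)) _ (χp t).toAlgebra (𝔮p t).asIdeal _)
    (h𝔮p : ∀ t, (𝔮p t).asIdeal.comap (algebraMap _ (blowupAlgebra (Ideal.span (Set.range c)) (c (i t)))) =
      maximalIdeal (F₁.presheaf.stalk x))
    (wp : ∀ t, {l : Fin 3 // l ≠ i t} → F₁.presheaf.stalk x) (hwp : ∀ t l, πk (wp t l) = a t l)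
    (hfrp : ∀ t (l : {l : Fin 3 // l ≠ i t}), blowupAlgebra.frac c (i t) l.1 - algebraMap _ _ (wp t l) ∈ (𝔮p t).asIdeal)
    (w : F₂) (hwZ : w ∈ υ ⁻¹' {x} ∩ closure (υ ⁻¹' ((W : Set F₁) \ {x})))
    (hnreg : ¬ IsRegularLocalRing (F₂.presheaf.stalk w ⧸
      stalkIdeal (vanishingIdeal (⟨υ ⁻¹' {x} ∩ closure (υ ⁻¹' ((W : Set F₁) \ {x})), hZ⟩ : Closeds F₂)) w)) :
    ∃ t, w = y' t := by
  classical
  set Zi := vanishingIdeal (⟨υ ⁻¹' {x} ∩ closure (υ ⁻¹' ((W : Set F₁) \ {x})), hZ⟩ : Closeds F₂) with hZi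
  have hwx : υ w = x := hwZ.1
  have hcJ : Ideal.span (Set.range c) = stalkIdeal (vanishingIdeal ⟨{x}, hx⟩) x := by
    rw [hc𝔪, stalkIdeal_vanishingIdeal_singleton hx]
  -- (1) a chart presentation of `w`
  obtain ⟨jj, 𝔔, χ, hχ, hloc, h𝔔⟩ := exists_chartPresentation_of_eq hυ w hwx c hcJ
  haveI : IsDomain (MvPolynomial {l : Fin 3 // l ≠ jj} k') := inferInstance
  haveI : IsRegularRing k' := inferInstance
  haveI : IsRegularRing (MvPolynomial {l : Fin 3 // l ≠ jj} k') := MvPolynomial.isRegularRing_of_isRegularRing _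
  have hχhom : ∀ r, χ (algebraMap _ _ r) = (υ.stalkMap w).hom ((F₁.presheaf.stalkCongr (.of_eq hwx.symm)).hom r) :=
    fun r => (hχ r).trans (stalkCongr_inv_comp_apply_eq hwx r)
  letI algχ := χ.toAlgebra
  haveI : IsLocalization.AtPrime (F₂.presheaf.stalk w) 𝔔.asIdeal := hloc
  let eA : F₂.presheaf.stalk w ≃ₐ[blowupAlgebra (Ideal.span (Set.range c)) (c jj)] Localization.AtPrime 𝔔.asIdeal :=
    IsLocalization.algEquiv 𝔔.asIdeal.primeCompl _ _
  have he : ∀ b, eA.toRingEquiv (χ b) = algebraMap _ (Localization.AtPrime 𝔔.asIdeal) b := fun b => eA.commutes b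
  have h𝔔χ : ∀ b', b' ∈ 𝔔.asIdeal ↔ χ b' ∈ maximalIdeal (F₂.presheaf.stalk w) :=
    fun b' => mem_chartPrime_iff_apply_mem_maximalIdeal 𝔔 χ hloc b'
  -- notation on the chart `jj`
  set Gj : blowupAlgebra (Ideal.span (Set.range c)) (c jj) := MvPolynomial.aeval (blowupAlgebra.frac c jj) G with hGjdef
  set tj : blowupAlgebra (Ideal.span (Set.range c)) (c jj) :=
    algebraMap (F₁.presheaf.stalk x) (blowupAlgebra (Ideal.span (Set.range c)) (c jj)) (c jj) with htj
  set gbar : MvPolynomial {l : Fin 3 // l ≠ jj} k' := MvPolynomial.map πk (dehomogenize jj G) with hgbar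
  have hgbar' : gbar = dehomogenize jj (MvPolynomial.map πk G) := map_dehomogenize jj πk G
  have hgbar0 : gbar ≠ 0 := by rw [hgbar']; exact dehomogenize_ne_zero_of_isHomogeneous jj hgdg hg0
  -- `k₀ = 𝒪_{F₁,x}/(c̄) ≅ k'` along `πk`, and the chart map `Θ : B_jj → B_jj/(t_jj) ≅ k₀[T] ≅ k'[T]` (verbatim from res-L1-w45b-stub-2)
  let ek : (F₁.presheaf.stalk x ⧸ Ideal.span (Set.range c)) ≃+* k' :=
    (Ideal.quotEquivOfEq hkerπ.symm).trans (RingHom.quotientKerEquivOfSurjective hπk)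
  have hek : ∀ r, ek (Ideal.Quotient.mk (Ideal.span (Set.range c)) r) = πk r := fun r => by
    change RingHom.quotientKerEquivOfSurjective hπk (Ideal.quotEquivOfEq hkerπ.symm (Ideal.Quotient.mk _ r)) = πk r
    rw [Ideal.quotEquivOfEq_mk, RingHom.quotientKerEquivOfSurjective_apply_mk]
  let E := blowupAlgebraQuotEquiv c jj hc
  let Θ : blowupAlgebra (Ideal.span (Set.range c)) (c jj) →+* MvPolynomial {l : Fin 3 // l ≠ jj} k' :=
    (MvPolynomial.map (ek : _ →+* k')).comp
      ((E.symm : _ →+* MvPolynomial {l : Fin 3 // l ≠ jj} (F₁.presheaf.stalk x ⧸ Ideal.span (Set.range c))).comp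
        (Ideal.Quotient.mk (Ideal.span {tj})))
  have hΘsurj : Function.Surjective Θ := by
    intro q
    obtain ⟨p, rfl⟩ :=
      MvPolynomial.map_surjective (ek : (F₁.presheaf.stalk x ⧸ Ideal.span (Set.range c)) →+* k') ek.surjective q
    obtain ⟨q, rfl⟩ := E.symm.surjective p
    obtain ⟨b, rfl⟩ := Ideal.Quotient.mk_surjective q
    exact ⟨b, rfl⟩
  have hΘt : Θ tj = 0 := by
    change MvPolynomial.map (ek : _ →+* k') (E.symm (Ideal.Quotient.mk _ tj)) = 0
    rw [Ideal.Quotient.eq_zero_iff_mem.mpr (Ideal.mem_span_singleton_self tj), map_zero, map_zero]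
  have hΘG : Θ Gj = gbar := by
    change MvPolynomial.map (ek : _ →+* k') (E.symm (Ideal.Quotient.mk _ Gj)) = gbar
    have h1 : E.symm (Ideal.Quotient.mk _ Gj) =
        MvPolynomial.map (Ideal.Quotient.mk (Ideal.span (Set.range c))) (dehomogenize jj G) := by
      rw [RingEquiv.symm_apply_eq, hGjdef]; exact mk_coneTransform_eq c jj hc G
    rw [h1, MvPolynomial.map_map, hgbar,
      show (ek : _ →+* k').comp (Ideal.Quotient.mk (Ideal.span (Set.range c))) = πk from RingHom.ext hek]
  have hΘC : ∀ r, Θ (algebraMap _ _ r) = MvPolynomial.C (πk r) := by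
    intro r
    change MvPolynomial.map (ek : _ →+* k') (E.symm (Ideal.Quotient.mk _ (algebraMap _ _ r))) = _
    have h1 : E.symm (Ideal.Quotient.mk _ (algebraMap _ _ r)) = MvPolynomial.C (Ideal.Quotient.mk _ r) := by
      rw [RingEquiv.symm_apply_eq]; exact (blowupAlgebraQuotEquiv_C c jj hc r).symm
    rw [h1, MvPolynomial.map_C]
    exact congrArg _ (hek r)
  have hΘfrac : ∀ l : {l : Fin 3 // l ≠ jj}, Θ (blowupAlgebra.frac c jj l.1) = MvPolynomial.X l := by
    intro l
    change MvPolynomial.map (ek : _ →+* k') (E.symm (Ideal.Quotient.mk _ (blowupAlgebra.frac c jj l.1))) = _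
    have h1 : E.symm (Ideal.Quotient.mk _ (blowupAlgebra.frac c jj l.1)) = MvPolynomial.X l := by
      rw [RingEquiv.symm_apply_eq]; exact (blowupAlgebraQuotEquiv_X c jj hc l).symm
    rw [h1, MvPolynomial.map_X]
  have hkerΘ : ∀ y : blowupAlgebra (Ideal.span (Set.range c)) (c jj), Θ y = 0 ↔ y ∈ Ideal.span {tj} := fun y => by
    rw [← Ideal.Quotient.eq_zero_iff_mem]
    change MvPolynomial.map (ek : _ →+* k') (E.symm (Ideal.Quotient.mk _ y)) = 0 ↔ _
    constructor
    · intro h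
      have h1 : E.symm (Ideal.Quotient.mk _ y) = 0 := by
        apply MvPolynomial.map_injective (ek : (F₁.presheaf.stalk x ⧸ Ideal.span (Set.range c)) →+* k') ek.injective
        rw [map_zero]
        exact h
      exact (map_eq_zero_iff _ E.symm.injective).mp h1
    · intro h
      rw [h, map_zero, map_zero]
  -- (2) `t_jj ∈ 𝔔` and, since `w ∈ Z₂ = supp 𝓘(Z₂)`, `G_jj ∈ 𝔔`
  have ht𝔔 : tj ∈ 𝔔.asIdeal := by
    rw [htj, ← Ideal.mem_comap, h𝔔, ← hc𝔪]
    exact Ideal.subset_span (Set.mem_range_self jj)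
  have hsupp : w ∈ Zi.support := by
    rw [← SetLike.mem_coe, hZi, Scheme.IdealSheafData.coe_support_vanishingIdeal]
    exact hwZ
  have hst := stalkIdeal_carrierTrace_of_presentation' hx w hwx c hc𝔪 hc W Φ G hΦd hΦ hW hΦG hGΦ hGrad hZ jj 𝔔 χ
    eA.toRingEquiv hχhom he
  have hG𝔔 : Gj ∈ 𝔔.asIdeal := by
    have h := (mem_support_iff_stalkIdeal_le Zi w).mp hsupp
    rw [← hZi] at hst
    rw [hst, sup_le_iff, Ideal.span_singleton_le_iff_mem] at h
    exact (h𝔔χ Gj).mpr h.1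
  -- (3) the prime `𝔮 = Θ(𝔔)` of `k'[T_l : l ≠ jj]`, `𝔔 = Θ⁻¹ 𝔮`
  have hkerle : RingHom.ker Θ ≤ 𝔔.asIdeal := by
    intro y hy
    have hy' : y ∈ Ideal.span {tj} := (hkerΘ y).mp hy
    exact (Ideal.span_singleton_le_iff_mem _).mpr ht𝔔 hy'
  haveI h𝔮pr : (𝔔.asIdeal.map Θ).IsPrime := Ideal.map_isPrime_of_surjective hΘsurj hkerle
  set 𝔮 : PrimeSpectrum (MvPolynomial {l : Fin 3 // l ≠ jj} k') := ⟨𝔔.asIdeal.map Θ, h𝔮pr⟩ with h𝔮def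
  have h𝔮𝔔 : 𝔮.asIdeal.comap Θ = 𝔔.asIdeal := by
    change (𝔔.asIdeal.map Θ).comap Θ = 𝔔.asIdeal
    rw [Ideal.comap_map_of_surjective Θ hΘsurj, sup_eq_left]
    intro y hy
    exact hkerle ((RingHom.mem_ker).mpr (by simpa using hy))
  have hg𝔮 : gbar ∈ 𝔮.asIdeal := by
    rw [← hΘG]; exact Ideal.mem_map_of_mem Θ hG𝔔
  -- (4) non-regular ⇒ `ḡ_jj ∈ 𝔪_𝔮²`: the trace local ring is `(k'[T]/(ḡ_jj))_𝔮`
  have hpc : (𝔮.asIdeal.comap Θ).primeCompl = 𝔔.asIdeal.primeCompl := by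
    ext y; simp only [Ideal.mem_primeCompl_iff, h𝔮𝔔]
  have hloc' : @IsLocalization.AtPrime _ _ (F₂.presheaf.stalk w) _ χ.toAlgebra (𝔮.asIdeal.comap Θ)
      (Ideal.comap_isPrime Θ 𝔮.asIdeal) := by
    change IsLocalization (𝔮.asIdeal.comap Θ).primeCompl (F₂.presheaf.stalk w)
    rw [hpc]; exact hloc
  have hker𝔮 : RingHom.ker (Ideal.Quotient.mk (Ideal.span {gbar})) ≤ 𝔮.asIdeal := by
    rw [Ideal.mk_ker, Ideal.span_singleton_le_iff_mem]; exact hg𝔮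
  haveI hQ' : (𝔮.asIdeal.map (Ideal.Quotient.mk (Ideal.span {gbar}))).IsPrime :=
    Ideal.map_isPrime_of_surjective Ideal.Quotient.mk_surjective hker𝔮
  have hQ'c : (𝔮.asIdeal.map (Ideal.Quotient.mk (Ideal.span {gbar}))).comap (Ideal.Quotient.mk (Ideal.span {gbar})) =
      𝔮.asIdeal := by
    rw [Ideal.comap_map_of_surjective _ Ideal.Quotient.mk_surjective, ← RingHom.ker_eq_comap_bot, sup_eq_left]
    exact hker𝔮
  obtain ⟨Λ, hΛsurj, hkerΛ'⟩ := exists_surjective_ker_eq_of_isLocalization_comap Θ hΘsurj tj Gj gbar hΘG hkerΘ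
    𝔮.asIdeal hg𝔮 χ hloc'
  have hkerΛ : RingHom.ker Λ = stalkIdeal Zi w := by rw [hkerΛ', hZi, hst]
  have hnregL : ¬ IsRegularLocalRing (Localization.AtPrime (𝔮.asIdeal.map (Ideal.Quotient.mk (Ideal.span {gbar})))) := by
    intro hL
    apply hnreg
    have h1 : IsRegularLocalRing (F₂.presheaf.stalk w ⧸ RingHom.ker Λ) :=
      @IsRegularLocalRing.of_ringEquiv _ _ hL _ _ (RingHom.quotientKerEquivOfSurjective hΛsurj).symm
    exact @IsRegularLocalRing.of_ringEquiv _ _ h1 _ _ (Ideal.quotEquivOfEq hkerΛ)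
  have hsq' : algebraMap _ (Localization.AtPrime ((𝔮.asIdeal.map (Ideal.Quotient.mk (Ideal.span {gbar}))).comap
      (Ideal.Quotient.mk (Ideal.span {gbar})))) gbar ∈ maximalIdeal _ ^ 2 := by
    by_contra hnot
    exact hnregL ((isRegularLocalRing_localization_quotient_iff_notMem_sq hgbar0 _).mpr hnot)
  have hsq : algebraMap _ (Localization.AtPrime 𝔮.asIdeal) gbar ∈ maximalIdeal (Localization.AtPrime 𝔮.asIdeal) ^ 2 :=
    algebraMap_mem_maximalIdeal_sq_of_eq gbar _ _ hQ'c.symm hsq'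
  -- (5) COVER: `𝔮` is the point ideal of a cluster member `t` visible on the chart `jj`
  obtain ⟨t, hât, h𝔮eq⟩ := hF.2.2 jj 𝔮 (by rw [← hgbar']; exact hg𝔮) (by rw [← hgbar']; exact hsq)
  -- chart-`jj` coordinates of `w`: lifts of `â_t l / â_t jj`
  obtain ⟨bR, hbR⟩ : ∃ bR : {l : Fin 3 // l ≠ jj} → F₁.presheaf.stalk x, ∀ l, πk (bR l) =
      (if h : (l : Fin 3) = i t then (1 : k') else a t ⟨l, h⟩) / (if h : jj = i t then (1 : k') else a t ⟨jj, h⟩) :=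
    ⟨fun l => (hπk _).choose, fun l => (hπk _).choose_spec⟩
  have hfrw : ∀ l : {l : Fin 3 // l ≠ jj}, blowupAlgebra.frac c jj l.1 - algebraMap _ _ (bR l) ∈ 𝔔.asIdeal := by
    intro l
    rw [← h𝔮𝔔, Ideal.mem_comap, map_sub, hΘfrac, hΘC, hbR, h𝔮eq]
    exact Ideal.subset_span ⟨l, rfl⟩
  -- (6) the coordinate point is the cluster point `y′ t`
  exact ⟨t, eq_clusterPoint_of_forall_frac_sub_mem hx hυ c hc𝔪 πk hkerπ i a y' hy' 𝔮p χp hχp hlocp h𝔮p wp hwp hfrp t jj hât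
    w hwx 𝔔 χ hχ hloc h𝔔 bR hbR hfrw⟩

/-- **(D3c) THE CANDIDATE CENTRES ARE CLUSTER POINTS: `TCPlusPlus.Cand F₂ Z₂ ∅ ⊆ Set.range y′`.** In the setting of
`exists_eq_clusterPoint_of_not_isRegularLocalRing`: every untracked candidate centre of the stage `(F₂, T₂, Z₂, ∅)` of the TC⁺⁺ driver —
a closed point of the reduced curve `V(closure Z₂)_red` at which it is not regular — is one of the cluster points `y′ t`.
[cite: StacksProject, Tag 0804; StacksProject, Tag 0BIQ] [OURS · L1 W4.5b] (δ) D3 POINT-DICT; NOT a statement of the manuscript. -/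
theorem cand_subset_range_clusterPoint [IsLocallyNoetherian F₂] (hx : IsClosed ({x} : Set F₁))
    (hυ : IsBlowup υ (vanishingIdeal ⟨{x}, hx⟩))
    (c : Fin 3 → F₁.presheaf.stalk x) (hc𝔪 : Ideal.span (Set.range c) = maximalIdeal (F₁.presheaf.stalk x))
    (hc : IsQuasiRegular c) {k' : Type} [Field k'] (πk : F₁.presheaf.stalk x →+* k') (hπk : Function.Surjective πk)
    (hkerπ : RingHom.ker πk = Ideal.span (Set.range c)) (W : Closeds F₁) {d : ℕ}
    (Φ G : MvPolynomial (Fin 3) (F₁.presheaf.stalk x))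
    (hΦd : Φ.IsHomogeneous d) (hΦ : MvPolynomial.map (Ideal.Quotient.mk (Ideal.span (Set.range c))) Φ ≠ 0)
    (hW : stalkIdeal (vanishingIdeal W) x = Ideal.span {MvPolynomial.eval c Φ})
    (hΦG : MvPolynomial.map (Ideal.Quotient.mk (Ideal.span (Set.range c))) Φ ∈
      (Ideal.span {MvPolynomial.map (Ideal.Quotient.mk (Ideal.span (Set.range c))) G}).radical)
    (hGΦ : MvPolynomial.map (Ideal.Quotient.mk (Ideal.span (Set.range c))) G ∈
      (Ideal.span {MvPolynomial.map (Ideal.Quotient.mk (Ideal.span (Set.range c))) Φ}).radical)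
    (hGrad : ∀ j, (Ideal.span {MvPolynomial.map (Ideal.Quotient.mk (Ideal.span (Set.range c)))
      (dehomogenize j G)}).IsRadical)
    {dg : ℕ} (hgdg : (MvPolynomial.map πk G).IsHomogeneous dg) (hg0 : MvPolynomial.map πk G ≠ 0)
    {s : ℕ} (i : Fin s → Fin 3) (a : (t : Fin s) → {j : Fin 3 // j ≠ i t} → k') (m : Fin s → ℕ)
    (hF : FatCluster (MvPolynomial.map πk G) s i a m)
    (y' : Fin s → F₂) (hy' : ∀ t, υ (y' t) = x)
    (𝔮p : ∀ t, PrimeSpectrum (blowupAlgebra (Ideal.span (Set.range c)) (c (i t))))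
    (χp : ∀ t, blowupAlgebra (Ideal.span (Set.range c)) (c (i t)) →+* F₂.presheaf.stalk (y' t))
    (hχp : ∀ t r, χp t (algebraMap _ _ r) = ((F₁.presheaf.stalkCongr (.of_eq (hy' t))).inv ≫ υ.stalkMap (y' t)).hom r)
    (hlocp : ∀ t, @IsLocalization.AtPrime _ _ (F₂.presheaf.stalk (y' t)) _ (χp t).toAlgebra (𝔮p t).asIdeal _)
    (h𝔮p : ∀ t, (𝔮p t).asIdeal.comap (algebraMap _ (blowupAlgebra (Ideal.span (Set.range c)) (c (i t)))) =
      maximalIdeal (F₁.presheaf.stalk x))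
    (wp : ∀ t, {l : Fin 3 // l ≠ i t} → F₁.presheaf.stalk x) (hwp : ∀ t l, πk (wp t l) = a t l)
    (hfrp : ∀ t (l : {l : Fin 3 // l ≠ i t}), blowupAlgebra.frac c (i t) l.1 - algebraMap _ _ (wp t l) ∈ (𝔮p t).asIdeal) :
    TCPlusPlus.Cand F₂ (υ ⁻¹' {x} ∩ closure (υ ⁻¹' ((W : Set F₁) \ {x}))) ∅ ⊆ Set.range y' := by
  classical
  have hZ : IsClosed (υ ⁻¹' {x} ∩ closure (υ ⁻¹' ((W : Set F₁) \ {x}))) :=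
    (hx.preimage υ.continuous).inter isClosed_closure
  rintro w ⟨-, -, y'', hy''w, hnreg⟩
  -- the closure spelling of `Cand` versus the closed trace
  have hcl : (⟨closure (υ ⁻¹' {x} ∩ closure (υ ⁻¹' ((W : Set F₁) \ {x}))), isClosed_closure⟩ : Closeds F₂) =
      ⟨υ ⁻¹' {x} ∩ closure (υ ⁻¹' ((W : Set F₁) \ {x})), hZ⟩ := Closeds.ext hZ.closure_eq
  have hZi : vanishingIdeal (⟨closure (υ ⁻¹' {x} ∩ closure (υ ⁻¹' ((W : Set F₁) \ {x}))), isClosed_closure⟩ : Closeds F₂) =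
      vanishingIdeal (⟨υ ⁻¹' {x} ∩ closure (υ ⁻¹' ((W : Set F₁) \ {x})), hZ⟩ : Closeds F₂) := by rw [hcl]
  have hwZ : w ∈ υ ⁻¹' {x} ∩ closure (υ ⁻¹' ((W : Set F₁) \ {x})) := by
    have h := Set.mem_range_self (f := fun z => ((vanishingIdeal (⟨closure (υ ⁻¹' {x} ∩ closure (υ ⁻¹' ((W : Set F₁) \ {x}))),
      isClosed_closure⟩ : Closeds F₂)).subschemeι z : F₂)) y''
    rw [Scheme.IdealSheafData.range_subschemeι, Scheme.IdealSheafData.coe_support_vanishingIdeal] at h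
    rw [← hy''w]
    exact hZ.closure_subset h
  have hnreg' : ¬ IsRegularLocalRing (F₂.presheaf.stalk w ⧸
      stalkIdeal (vanishingIdeal (⟨υ ⁻¹' {x} ∩ closure (υ ⁻¹' ((W : Set F₁) \ {x})), hZ⟩ : Closeds F₂)) w) := by
    intro hreg
    apply hnreg
    obtain ⟨eq⟩ := nonempty_stalkSubschemeEquiv
      (vanishingIdeal (⟨closure (υ ⁻¹' {x} ∩ closure (υ ⁻¹' ((W : Set F₁) \ {x}))), isClosed_closure⟩ : Closeds F₂)) y''
    rw [hy''w] at eq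
    have h1 : IsRegularLocalRing (F₂.presheaf.stalk w ⧸ stalkIdeal (vanishingIdeal (⟨closure (υ ⁻¹' {x} ∩
        closure (υ ⁻¹' ((W : Set F₁) \ {x}))), isClosed_closure⟩ : Closeds F₂)) w) := by
      rw [hZi]; exact hreg
    exact @IsRegularLocalRing.of_ringEquiv _ _ h1 _ _ eq
  obtain ⟨t, ht⟩ := exists_eq_clusterPoint_of_not_isRegularLocalRing hx hυ c hc𝔪 hc πk hπk hkerπ W Φ G hΦd hΦ hW hΦG hGΦ hGrad
    hgdg hg0 hZ i a m hF y' hy' 𝔮p χp hχp hlocp h𝔮p wp hwp hfrp w hwZ hnreg'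
  exact ⟨t, ht.symm⟩

end Cover

end Summit.ResolutionOfSingularities.ResolutionOfSingularities.Cruxes.EquisingularLiftNat.Sections

end
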